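import Literature.NumberTheory.EllipticCurves.MordellCurveThreeDescent
import Literature.NumberTheory.EllipticCurves.AnalyticRank
import HarnessLib

/-!
# Yin 2026 (arXiv:2605.25917, arXiv:2607.01744): explicit CM points on `x³ + y³ = p`, `x³ + y³ = p²` for primes `p ≡ 4, 7 (mod 9)` — the two claimed theorems, as NAMED HYPOTHESES

HONEST FRAMING (cell `bsd-cn100`, `run/shared/lean/pub/bsd-cn100/`; companion at `p = 3` of the
congruent-number work in `Kriz2020/`). This file vendors the two load-bearing CLAIMS of two
UNREFEREED 2026 preprints of Hongbo Yin as named facts (`def … : Prop`; nothing is asserted,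
D-0014), in the vocabulary of the tree, so that the sibling proof file
`Yin2026/SylvesterFourSevenProofs.lean` can show exactly what follows from them and from
published inputs: Sylvester's statement for the primes `p ≡ 4, 7 (mod 9)` (for `p` AND `p²`),
`rank E_p(ℚ) = 1 = corank Sel_{3^∞}` with `Ш(E_p)[3^∞]` of corank `0` (with Satgé's bound),
and — the summit-bearing clause — `ord_{s=1} L(E_{p^i}, s) = rank E_{p^i}(ℚ) = 1`,
`#Ш(E_{p^i}) < ∞` (with Gross–Zagier–Kolyvagin). This is a SECOND DOOR to the Sylvester
companion, independent of the first one (`Kriz2020/SylvesterProofs.lean`, binder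
`rankOne_threeConverse_mordellCurve` = the rank-one `3`-converse claimed by Kříž v5 / Fan–Wan
v2, both adjudicated GAP-LOCALISED by the cell, `VERDICT.md` Parts I–IV): no `p`-converse, no
Iwasawa theory, no parity theorem and no Selmer input are used on Yin's route; on the other hand
it says nothing about `p ≡ 8 (mod 9)`.

## Citation header (read by this seat from the sources named)

* [Y1] Hongbo Yin, *A proof of the `4, 7` cases of Sylvester's conjecture on cube sums*,
  arXiv:2605.25917 [math.NT], v1 2026-05-25, v3 2026-06-04 (30 pp.). Bib key
  `Yin2026SylvesterFourSeven`. Text of record: the v3 e-print source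
  `run/shared/lean/pub/bsd-cn100/yin-2026/Yin_v3_Sylvester-proof.tex` (1700 lines, sha256
  8458315b…); line numbers `l. N` below are TeX lines of that file.
  Verbatim, Thm. 1.1 (`\label{main}`, l. 411) = Thm. 8.7 (l. 1527): "Let `p ≡ 4, 7 mod 9` be a
  prime, both `p` and `p²` are sums of two rational cubes." Thm. 8.6 (`\label{non-torsion}`,
  l. 1511): "Let `r` be an integer such that `r² − r + 1 ≡ 0 mod 3p`. If `−r ≡ ω² mod ϖ`, then
  `φ(τ_r)` and `φ^c(W(τ_r))` are non-torsion. …". Proof of Thm. 8.7 (l. 1529–1541), for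
  `i = 1, 2` and the model `E_{p^i} : y² = x³ + p^{2i}/4`: "`ϕ(φ(τ_r)) ∈ E_{p^i}(K)` is
  non-torsion. If the complex conjugate … then `[√−3]ϕ(φ(τ_r)) ∈ E_{p^i}(ℚ)` is non-torsion.
  Otherwise `\overline{ϕ(φ(τ_r))} + ϕ(φ(τ_r))` belongs to `E_{p^i}(ℚ)` is non-torsion." — i.e.
  THE CLAIM IS: `E_{p^i}(ℚ)` has a point of infinite order (`i = 1, 2`). Mechanism: explicit CM
  points `τ_r = −1/(3(ω + r))` on `X_Γ`, `Γ = {γ ∈ Γ₀(N) : d mod p a cube}`, `N = 9p` or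
  `27p`, pushed through Shimura's modular parametrisations `X_Γ → E_{ϖ̄^i}` over
  `K = ℚ(√−3)` and a cubic twist; non-torsion via cube roots of modular functions and the
  Unbounded Denominators theorem (Calegari–Dimitrov–Tang, JAMS 38 (2025)), Manin–Stevens
  constants via Burungale–Flach (Camb. J. Math. 12 (2024)).
* [Y2] Hongbo Yin, *Gross–Zagier formula for the `4, 7` cases of Sylvester's conjecture*,
  arXiv:2607.01744 [math.NT], v1 2026-07-02 (23 pp.). Bib key `Yin2026SylvesterGrossZagier`.
  Text of record: `…/yin-2026/Yin_GZ_v1_Sylvester-GZ.tex` (1047 lines, sha256 4452c257…).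
  Verbatim, Thm. 1.1 (`\label{main}`, l. 415), with (l. 414) "by the result of [Yin26],
  `ϕ∘φ(τ_r) ∈ E_{p^i}(K)` is a non-torsion point. Let `Ω_{p^i}` be the Neron periods of
  `E_{p^i}` and `ĥ_ℚ` be the Neron–Tate height with base field `ℚ`":
  "We have `L'(E_{p^i}, 1)/Ω_{p^i} = 2^{δ(p^i)} ĥ_ℚ(ϕ∘φ(τ_r))` where `δ(p^i) = 0` if
  `p^i ≡ 4 mod 9`, `−1` if `p^i ≡ 7 mod 9`." Mechanism: Yuan–Zhang–Zhang's general
  Gross–Zagier formula on `Res_{K/ℚ} E_{ϖ̄^i}` with Cai–Shu–Tian's variation (ANT 8 (2014),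
  Thm. 1.6) and new local Waldspurger period integrals at `3` and `p` (§4).
* STATUS (2026-08-25): BOTH PREPRINTS ARE UNREFEREED (no journal reference, no DOI; [Y1] is
  three months old, [Y2] seven weeks). The cell's two independent adversarial reads of [Y1] v3
  (`GAP-LEDGER-read1-yin-v3.md`, §§2–5; `GAP-LEDGER-read2-yin-v3.md`, §§6–10) record no
  disproof of Thm. 1.1 but several open load-bearing points on the §8 route (the `ν/ω`-power
  bookkeeping cluster, the meromorphic use of the Unbounded Denominators theorem — Remark 8.2,
  "communicated by the authors" —, the cusp-image/`Γ`-invariance infrastructure) and one broken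
  lemma proof in §3; their combined bottom line is "MAJOR GAPS — not established by this text as
  it stands", and the cell referee's adjudication (`VERDICT.md` Part V, 2026-08-25) is
  **GAP-LOCALISED**: 8 sustained FATAL/GAP entries in 5 independent clusters, 4 of them on the main
  §§2–8 route (deepest: the cusp-image `K`-rationality step of §3, entry read1-yin-1; independent:
  the Manin–Stevens `p`-part, open in print; the meromorphic CDT extension, unpublished) — explicitly
  "NOT a disproof … the Sylvester existence claim for `p ≡ 4, 7 (9)` REMAINS OPEN, not established by
  this text as it stands"; Thm. 8.6's four-case Kummer non-cube check and the §10 numerics were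
  verified sound by the readers. §9 of [Y1] (a route
  conditional on GRH / Artin's conjecture in arithmetic progressions, replacing the Unbounded
  Denominators input) rests on a hypothesis (⋆) that is false for prime moduli by quadratic
  reciprocity (lit flag Y-2, confirmed by read2) — it is not used anywhere below. Of [Y2] one
  half (§4) has been read (`GAP-LEDGER-read2-yin-gz.md`: no fatal entry, no gap; fixable
  normalisation slips); no adjudication (it opens only when the complementary read freezes), and the
  referee flags that the sequel's CM-point section inherits [Y1] §§2–5 wherever it consumes them.
  Elkies announced the `4, 7` case in 1994 without
  publication; Dasgupta–Voight, Proc. AMS 146 (2018), Thm. 2 prove `rank E_p(ℚ) = rank E_{p²}(ℚ)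
  = 1` for `p ≡ 4, 7 (mod 9)` with `3` not a cube mod `p` (refereed, partial). CONSEQUENTLY THE
  STATEMENTS BELOW ARE HYPOTHESES: never discharged in the tree, named as binders by every
  consumer; a refutation of either would be a theorem about Mordell–Weil groups or `L`-functions
  of the curves `y² = x³ − 432 p^{2i}`, not about this file.

## Transcription (word for word → tree vocabulary)

1. The curve. Yin: "we will use the elliptic curve `E_{p^i} : y² = x³ + p^{2i}/4` which is
   isogenous to `y² = x³ − 432 p^{2i}` over `ℚ`" ([Y1] l. 420, [Y2] l. 406). The tree's model of
   `x³ + y³ = d` is `mordellCurve (−(432 d²)) : Y² = X³ − 432 d²` (`MordellCurveThreeDescent.lean`;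
   model link `exists_cube_add_cube_of_mordellCurve_equation` in `Kriz2020/SylvesterProofs.lean`,
   Dasgupta–Voight 2018 §1.1), here with `d = p^i`, i.e. `d ∈ {p, p²}` — the binder
   `d = p ∨ d = p ^ 2` below. Both transcribed properties — "`E(ℚ)` has a point of infinite order"
   and "`L'(E, 1) ≠ 0`" — are invariant under the `ℚ`-isogeny the author names (a `ℚ`-isogeny
   maps a rational point of infinite order to one, and isogenous curves have the same `L`-function),
   so stating them on the tree's model neither weakens nor strengthens the printed claims.
2. "non-torsion point of `E_{p^i}(ℚ)`" — `∃ P : (mordellCurve _).toAffine.Point, ¬ IsOfFinAddOrder P`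
   (Mathlib's affine point group `E(ℚ)`; `IsOfFinAddOrder` = torsion).
3. "`L'(E_{p^i}, 1)`" — `deriv W.entireLFunction 1`, the derivative at `s = 1` of the tree's entire
   continuation of `L(W, s)` (`AnalyticRank.lean`; it exists for every `E/ℚ`, named facts
   `hasEntireLFunction_rat` (modularity) / `hasEntireLFunction_of_j_mem_maximalCMJInvariants`
   (Deuring–Hecke), and unconditionally in the tree when `w(E) = −1`,
   `WeierstrassCurve.hasEntireLFunction_of_rootNumber_eq_neg_one`).
4. What is transcribed of [Y2] is the CONSEQUENCE `L'(E_{p^i}, 1) ≠ 0` of the displayed identity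
   together with [Y1] Thm. 8.6 (one line: `Ω_{p^i} > 0` is a Néron period, and `ĥ_ℚ(Q) > 0` for a
   point `Q` of infinite order, Silverman AEC VIII.9.3 (d)) — not the identity itself, whose two
   sides (`Ω_{p^i}` of the model `y² = x³ + p^{2i}/4`, `ĥ_ℚ` in the normalisation of
   Yuan–Zhang–Zhang §7.1.1, the specific point `ϕ∘φ(τ_r) ∈ E(K)`) have no carrier-exact
   counterpart on the tree's model; the consequence is model-free and is all that any consumer
   uses (`ord_{s=1} L ≤ 1`). This makes the hypothesis WEAKER than the printed claim, never
   stronger. It depends on BOTH preprints ([Y2] Thm. 1.1 and [Y1] Thm. 8.6), as its name says.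
5. NOT transcribed (not claimed by the sources): anything for `p ≡ 8 (mod 9)`; any Selmer-group
   statement; the rank-BSD equality itself (it is DERIVED in the sibling file from these
   hypotheses and Gross–Zagier–Kolyvagin, exactly as print derives `rank = 1` from a Gross–Zagier
   formula plus a non-torsion Heegner point).

Nothing in this file is used by the tree except as an explicit hypothesis `(hY : …)`.
-/

noncomputable section

open scoped Classical

open WeierstrassCurve

namespace Literature.NumberTheory.EllipticCurves.Yin2026

/-- **Yin, arXiv:2605.25917v3, Theorem 8.7 (= Thm. 1.1) with its proof, l. 1527–1541 — CLAIMED,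
UNREFEREED; a hypothesis of the tree, never discharged** (status and the cell's gap ledgers: module
docstring). "Let `p ≡ 4, 7 mod 9` be a prime, then both `p` and `p²` are sums of two rational
cubes", proved in the source in the sharper form "`[√−3]ϕ(φ(τ_r)) ∈ E_{p^i}(ℚ)` is non-torsion.
Otherwise `\overline{ϕ(φ(τ_r))} + ϕ(φ(τ_r))` belongs to `E_{p^i}(ℚ)` is non-torsion"
(`i = 1, 2`; Thm. 8.6, l. 1511, supplies the non-torsion CM point). Transcribed on the tree's
model `Y² = X³ − 432 d²` of `x³ + y³ = d`, `d = p^i ∈ {p, p²}` (`ℚ`-isogenous to the source's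
`y² = x³ + p^{2i}/4`, l. 420; a `ℚ`-isogeny preserves points of infinite order): **`E_{p^i}(ℚ)`
has a point of infinite order.** [cite: Yin2026SylvesterFourSeven, Thm. 8.7 (= Thm. 1.1) and its proof, with Thm. 8.6 (v3, l. 1511–1541)] -/
def exists_not_isOfFinAddOrder_cubeSumCurve : Prop :=
  ∀ ⦃p : ℕ⦄, p.Prime → (p % 9 = 4 ∨ p % 9 = 7) → ∀ ⦃d : ℚ⦄, (d = p ∨ d = (p : ℚ) ^ 2) →
    ∃ P : (mordellCurve (-(432 * d ^ 2))).toAffine.Point, ¬ IsOfFinAddOrder P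

/-- **Yin, arXiv:2607.01744v1, Theorem 1.1 (explicit Gross–Zagier formula), combined with
arXiv:2605.25917v3, Theorem 8.6 (non-torsion) — CLAIMED, UNREFEREED; a hypothesis of the tree,
never discharged** (status: module docstring). "We have
`L'(E_{p^i}, 1)/Ω_{p^i} = 2^{δ(p^i)} ĥ_ℚ(ϕ∘φ(τ_r))`" (`p ≡ 4, 7 (mod 9)` prime, `i = 1, 2`,
`δ ∈ {0, −1}`, `Ω_{p^i}` the Néron period, `ĥ_ℚ` the Néron–Tate height), where "by the result of
[Yin26], `ϕ∘φ(τ_r) ∈ E_{p^i}(K)` is a non-torsion point" (l. 414–418). Transcribed is the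
consequence both papers together assert: since `Ω_{p^i} > 0` and the height of a point of
infinite order is `> 0` (Silverman AEC VIII.9.3 (d)), **`L'(E_{p^i}, 1) ≠ 0`** — on the tree's
model `Y² = X³ − 432 d²`, `d ∈ {p, p²}` (`ℚ`-isogenous to the source's model, l. 406; isogenous
curves have the same `L`-function), with `L'(E, 1) = deriv W.entireLFunction 1`.
[cite: Yin2026SylvesterGrossZagier, Thm. 1.1 (v1, l. 415) with l. 414]
[cite: Yin2026SylvesterFourSeven, Thm. 8.6 (v3, l. 1511)] -/
def deriv_entireLFunction_one_ne_zero_cubeSumCurve : Prop :=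
  ∀ ⦃p : ℕ⦄, p.Prime → (p % 9 = 4 ∨ p % 9 = 7) → ∀ ⦃d : ℚ⦄, (d = p ∨ d = (p : ℚ) ^ 2) →
    deriv (mordellCurve (-(432 * d ^ 2))).entireLFunction 1 ≠ 0

end Literature.NumberTheory.EllipticCurves.Yin2026

end
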